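import Summits.Ventures.WeilGRH.DualTrigKernelLatticeDefs
import HarnessLib

/-!
# Format D-K v3.2 (multi-lattice): the fast cell checker `DKCert3.checkP` — definitions

Cell `rh-explicit`, WEIL TRACK — GRH ARM, route B (weil-grh-3).  The v3 cell checker `cellsOKL`
(`DualTrigKernelLatticeDefs.lean`) treats every lattice atom `a cos(k r_p θ) + b sin(k r_p θ)` as a term of
NON-integer frequency `κ = k r_p`: per cell it evaluates one `expI` series for its centre phase and `2R` interval
products `W κ^m` for its moments, ≈ 5× the kernel cost of a base atom; and the Taylor remainder of a block is summed
as `Σ (|A|+|B|) κ^{2R} · η^{2R} / (2R)!` with `η^{2R}` an interval at scale `S`, which collapses to one unit in the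
last place once `η^{2R} S < 1` and then forces small Taylor orders `R`, i.e. small cells.  Two levers, same
mathematics, same certificate data (`DKCert3`):

* `latMom` — ONE centre phase `Z_p ∋ e^{i r_p θ_c}` per lattice per cell (`latPhase1`), the atoms' phases as
  running powers `Z_p^k` (`mcPow`), INTEGER-power moments `Σ_k W_k k^m` (`addTermK`, exact `ℤ` multiples) scaled
  once by `r_p^m` (`scaleMom`); `momentsP` = the base terms through `momentsB` (= `moments3` with the `O(R)` update `addTermI` for integer frequencies) + the lattices through `latsMom`.
* `remTermP` / `remBlockP` — the remainder in the product form `(|A|+|B|) (|κ| η⁺)^{2R} / (2R)!` (powers of the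
  interval `|κ| η⁺`), which is literally `RTerm.rem`.

`cellLoP` / `cellOKP` / `latDataP` / `blockRangeOKP` / `cellsOKP` / `checkP` are `cellLo3` / … / `checkL` with these
two sources; assembly lemmas `checkP_of_parts`, `blockRangeOKP_split`, `cellsOKP_of_blocks` for kernel-sized instance
declarations.  This file has definitions and three syntactic lemmas only (it imports the BUILT `DualTrigKernelLatticeDefs`,
so instance PART files can import it); soundness is `DualTrigKernelLatticeFast.lean`.
-/

noncomputable section

open Finset Real Complex

namespace Summit.Ventures.WeilGRH

open Literature.Analysis.ValidatedNumerics.NumericsMP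
open Literature.NumberTheory.LFunctions
open DualTrigTaylor DigammaVertical

namespace DKCert3

variable (c : DKCert3)

/-! ### The fast moment source -/

/-- `Z^n` by repeated interval multiplication. [folklore] -/
def mcPow (S : ℕ) (Z : MC) : ℕ → MC
  | 0 => MC.ofInt S 1
  | n + 1 => MC.mul S (mcPow S Z n) Z

/-- Fast moment update for an INTEGER frequency multiple `k`: `mom[m] += W_m · k^m` by structural recursion on the
moment list, the power carried along (arguments: current index `m`, current power `km = k^m`) — `O(R)` list operations
per term instead of the `O(R²)` of `DKCert.addTerm`'s indexed walks. [folklore] -/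
def addTermI (U V : MI) (k : ℤ) : ℕ → ℤ → List MI → List MI
  | _, _, [] => []
  | m, km, x :: xs => (x.add ((if m % 2 = 0 then U else V).mulInt km)) :: addTermI U V k (m + 1) (km * k) xs

/-- Add the INTEGER-power moments of one lattice atom (rotated coefficients `U`, `V`, multiple `k`):
`mom[m] += W_m · k^m`, `m < 2R` (exact integer multiples). [folklore] -/
def addTermK (U V : MI) (k : ℕ) (mom : List MI) : List MI := addTermI U V (k : ℤ) 0 1 mom

/-- Fast moment update of a base term: integer frequency through `addTermI`, interval frequency through
`DKCert.addTerm`. [folklore] -/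
def addTermF (t : DKCert.GTerm) (U V : MI) (mom : List MI) : List MI :=
  if t.isInt then addTermI U V (t.k : ℤ) 0 1 mom else c.base.addTerm t U V mom

/-- `DKCert3.moments3` with the fast update `addTermF`: the moments of a list of base terms on cell `j`
(pair: all terms, NON-periodic terms). [folklore] -/
def momentsB (b : DKBlock) (j : ℤ) : List DKCert.GTerm → Option (List MI × List MI)
  | [] => some (c.base.zeroMom, c.base.zeroMom)
  | t :: ts =>
    match momentsB b j ts with
    | none => none
    | some (accA, accN) =>
      match c.phase3 b j t with
      | none => none
      | some Z =>
        let UV := c.base.rotUV t Z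
        some (c.addTermF t UV.1 UV.2 accA, if t.comm then accN else c.addTermF t UV.1 UV.2 accN)

/-- The integer-power moments of a list of atoms of lattice `l` on a cell, the centre phases as running powers
of the unit phase `Z ∋ e^{i r_p θ_c}` (`kc`, `Zc ∋ e^{i kc r_p θ_c}` = the previous atom). [folklore] -/
def latMomAux (l : DKLat) (Z : MC) : ℕ → MC → List DKAtom → List MI
  | _, _, [] => c.base.zeroMom
  | kc, Zc, atm :: rest =>
    let Zk := if kc ≤ atm.k then MC.mul c.base.S Zc (mcPow c.base.S Z (atm.k - kc)) else mcPow c.base.S Z atm.k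
    let UV := c.base.rotUV (c.latAtomTerm l atm) Zk
    addTermK UV.1 UV.2 atm.k (latMomAux l Z atm.k Zk rest)

/-- Scale moment `m` by `rp[m]` (`∋ r_p^m`). [folklore] -/
def scaleMom (rp mom : List MI) : List MI :=
  (List.range (2 * c.base.R)).map fun m => MI.mul c.base.S (mom.getD m DKCert.dft) (rp.getD m DKCert.dft)

/-- Componentwise sum of two moment lists. [folklore] -/
def addMom (m1 m2 : List MI) : List MI :=
  (List.range (2 * c.base.R)).map fun m => (m1.getD m DKCert.dft).add (m2.getD m DKCert.dft)

/-- The unit centre phase of lattice `l` on cell `j` of block `b`: encloses `e^{i r_p θ_c}`, `θ_c = (2j+1)π/Mc`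
(short series `K2`/`k2`). [folklore] -/
def latPhase1 (b : DKBlock) (j : ℤ) (l : DKLat) : Option MC :=
  MC.expI c.base.S K2 k2 c.base.piI (MI.mul c.base.S l.rI ((c.base.piI.mulInt (2 * j + 1)).divNat b.Mc))

/-- The moments (`m < 2R`, at the centre of cell `j`) of the atoms of lattice `l`. [folklore] -/
def latMom (b : DKBlock) (j : ℤ) (l : DKLat) : Option (List MI) :=
  match c.latPhase1 b j l with
  | none => none
  | some Z => some (c.scaleMom (DKCert.powList c.base.S l.rI (2 * c.base.R + 1))
      (c.latMomAux l Z 0 (MC.ofInt c.base.S 1) l.atoms))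

/-- The moments of the atoms of a list of lattices (summed). [folklore] -/
def latsMom (b : DKBlock) (j : ℤ) : List DKLat → Option (List MI)
  | [] => some c.base.zeroMom
  | l :: ls =>
    match c.latMom b j l, latsMom b j ls with
    | some m, some ms => some (c.addMom m ms)
    | _, _ => none

/-- **The fast moments of all terms `terms3` on cell `j`**: the base terms through `momentsB`, the lattice
atoms through `latsMom`; the pair (all terms, NON-periodic terms) as `DKCert.moments`. [folklore] -/
def momentsP (b : DKBlock) (j : ℤ) : Option (List MI × List MI) :=
  match c.momentsB b j c.base.terms, c.latsMom b j c.lats with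
  | some acc, some lm => some (c.addMom acc.1 lm, c.addMom acc.2 lm)
  | _, _ => none

/-! ### The product-form remainder -/

/-- `η⁺` of a block as an interval. [folklore] -/
def etaI (b : DKBlock) : MI := MI.ofFrac c.base.S b.etaNum b.etaDen

/-- The powers `(|κ| η⁺)^m`, `m ≤ 2R+1`, of a term (intervals). [folklore] -/
def xPow (etaI : MI) (t : DKCert.GTerm) : List MI :=
  DKCert.powList c.base.S (MI.mul c.base.S (DKCert.absUp t.rI) etaI) (2 * c.base.R + 1)

/-- The Taylor remainder bound of a term from a list `xp ∋ (|κ| η⁺)^m`: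
`(|A|+|B|)·(xp[2R]/(2R)! + xp[2R+1]/(2R+1)!)`. [folklore] -/
def remTermX (xp : List MI) (t : DKCert.GTerm) : MI :=
  let ab := (DKCert.absUp t.A).add (DKCert.absUp t.B)
  (MI.mul c.base.S ab ((xp.getD (2 * c.base.R) DKCert.dft).divNat (2 * c.base.R).factorial)).add
    (MI.mul c.base.S ab ((xp.getD (2 * c.base.R + 1) DKCert.dft).divNat (2 * c.base.R + 1).factorial))

/-- The Taylor remainder bound of a term, `(|A|+|B|)·((|κ| η⁺)^{2R}/(2R)! + (|κ|η⁺)^{2R+1}/(2R+1)!)`, from the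
powers of the interval `|κ| η⁺` (no separate `η^{2R}`, no underflow). [folklore] -/
def remTermP (etaI : MI) (t : DKCert.GTerm) : MI := c.remTermX (c.xPow etaI t) t

/-- The total product-form remainder bound of a term list on a block. [folklore] -/
def remBlockP (etaI : MI) (ts : List DKCert.GTerm) : MI :=
  (ts.map (c.remTermP etaI)).foldr MI.add (MI.ofInt c.base.S 0)

/-! ### Cells -/

/-- `cellLo3` with the fast moments of `terms3` and a given remainder `E`: the two lower bounds (full
inequality, base periodic part) of cell `j`, scaled by `S`. [folklore] -/
def cellLoP (b : DKBlock) (E : MI) (j : ℤ) : Option (ℤ × ℤ) :=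
  match c.momentsP b j, c.base.digammaData b j with
  | some acc, some (BR, F0, F1, EF) =>
    let cs := c.base.coeffs acc.1
    let cs' := match cs with
      | c0 :: c1 :: rest => (((c0.add BR).add F0).add c.base.constI) :: (c1.add F1) :: rest
      | other => other
    some (c.base.innerLo b cs' - E.hi - EF.hi, c.base.innerLo b (c.base.coeffs (c.base.periodicMom acc)) - E.hi)
  | _, _ => none

/-- The full check of one cell (fast moments). [folklore] -/
def cellOKP (b : DKBlock) (E : MI) (j : ℤ) : Bool :=
  match c.cellLoP b E j with
  | some (lov, loT) => decide (0 ≤ lov) && (!DKCert.periodDuty b j || decide (c.base.mT ≤ loT))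
  | none => false

/-- The per-block data of the lattices with the product-form remainder: `(latTerms l, remBlockP)`. [folklore] -/
def latDataP (b : DKBlock) : List (List DKCert.GTerm × MI) :=
  c.lats.map fun l => (c.latTerms l, c.remBlockP (c.etaI b) (c.latTerms l))

/-- Check the cells `j0 + i`, `i0 ≤ i < i0 + cnt`, of a block (fast moments, product remainder): the full
inequality with ALL terms (and the base period duty), then the lattice duties (through `latCellsOKL` on the
product-remainder data). [folklore] -/
def blockRangeOKP (b : DKBlock) (i0 cnt : ℕ) : Bool :=
  let E := c.remBlockP (c.etaI b) c.terms3
  let ld := c.latDataP b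
  (List.range cnt).all fun i =>
    c.cellOKP b E (b.j0 + (i0 + i : ℕ)) && c.latCellsOKL b c.lats ld (b.j0 + (i0 + i : ℕ))

/-- All cells of all blocks (fast). [folklore] -/
def cellsOKP : Bool := c.base.blocks.all fun b => c.blockRangeOKP b 0 b.n

/-- **The complete v3.2 check**: frame and fast cells. [folklore] -/
def checkP : Bool := c.frame3OK && c.cellsOKP

variable {c}

/-! ### Assembly lemmas for kernel-sized declarations -/

/-- `checkP` from frame and cells. [folklore] -/
theorem checkP_of_parts (hf : c.frame3OK = true) (hc : c.cellsOKP = true) : c.checkP = true := by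
  unfold checkP; rw [hf, hc]; rfl

/-- Splitting a cell range of a block (fast checker). [folklore] -/
theorem blockRangeOKP_split (b : DKBlock) (i0 m n : ℕ) (h1 : c.blockRangeOKP b i0 m = true)
    (h2 : c.blockRangeOKP b (i0 + m) n = true) : c.blockRangeOKP b i0 (m + n) = true := by
  unfold blockRangeOKP at *
  simp only [List.all_eq_true, List.mem_range] at *
  intro i hi
  by_cases him : i < m
  · exact h1 i him
  · have h := h2 (i - m) (by omega)
    have e : i0 + m + (i - m) = i0 + i := by omega
    rw [e] at h
    exact h

/-- `cellsOKP` from one range per block. [folklore] -/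
theorem cellsOKP_of_blocks (h : ∀ b ∈ c.base.blocks, c.blockRangeOKP b 0 b.n = true) : c.cellsOKP = true := by
  unfold cellsOKP; rw [List.all_eq_true]; exact h

end DKCert3

end Summit.Ventures.WeilGRH

end
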